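import Literature.Probability.Percolation.FivePointHolomorphyFaces
import HarnessLib

/-!
# Two boundary laws for the five-point observables on a five-marked domain

Topic `Literature/Probability/Percolation`; lane pcv-sawmu (CriticalPhenomena), door (v-d) «what the five-disorder observables
compute». For the interface-layer observables of `FiveMarkedLoops.lean` (D1-v2: `Joined`, `InInterface`, `midEdgeEvent`,
`midEdgeProb`, `patternProb`, `sparseObs`) on an arbitrary five-marked discrete domain `D : TriMarkedDomain 5`
(Bollobás–Riordan 2006, Ch. 7 §7.2.2), two exact statements about BOUNDARY edges of `H_G`, both identities of events per
colouring under a single boundary condition (no loop space, no planarity):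

* SITE LAW (`IsExteriorFace.patternProb_eq` etc.): let `x` be an exterior boundary face — one vertex `u = faceVertex x k ∈ G`,
  the two others outside `G` — that is not a corner face (`IsExteriorFace.of_not_corner`). Its only `H_G`-neighbours are
  `x₁ = oppFace x (k+2)` and `x₂ = oppFace x (k+1)`, the two `H_G`-edges `{x₁, x}`, `{x, x₂}` are the duals of the two consecutive
  boundary darts `(u, v)`, `(u, v')` of the hexagon `u`, both sides of `x` carry the same exterior colour, and
  `Joined x₁ ∨ Joined x ↔ Joined x ↔ Joined x ∨ Joined x₂` for every colouring, reference corner and colour; hence the mid-edge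
  events, `midEdgeProb`, every `patternProb` and every `sparseObs` agree at the two edges: the boundary trace of the five-point
  observables is a function on boundary hexagons.
* CORNER LAW, same reference (`corner_patternProb_eq`): for the corner face `Y` of the reference mark `r` and any face `x`,
  `Joined x → Joined Y`; hence at any two `H_G`-edges containing `Y` (in particular the duals of `predDart r` and `markDart r`)
  the `r`-pattern probabilities coincide (both are `P[Match_M ∧ y_r off the interfaces]`).

Provenance: found post hoc on the exact tables of the lane's pre-registered boundary-value cell (MINING-PREREG Am. AI «P-BV5»,
four five-marked domains, two enumeration codes; then registered as predictions Am. AK «P-BV5-SITE»/«P-BV5-CORNER» for fresh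
shapes): 83/83 site groups and 125/125 corner class pairs exact; proved here for every domain. The cross-reference half of the
corner law and the boundary support / normalisation laws need the six-point boundary transport and are not in this file.

Status in print: Khristoforov–Smirnov 2021 §1.2 works with mid-edge disorders and boundary values arc by arc (eq. after
Remark 6, p. 5, three disorders); a per-hexagon constancy of boundary values and the same-reference corner identity for the
five-mark observables are not stated in print (lane bookkeeping facts over Bollobás–Riordan's marked domains; no new mathematics
beyond the interface definitions).

## References
* M. Khristoforov, S. Smirnov, *Percolation and O(1) loop model*, arXiv:2111.15612 (2021), §1.2 (loop configurations, Lemma 2,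
  pp. 3–4), §2 (Remark 6 and the boundary values, p. 5).
* B. Bollobás, O. Riordan, *Percolation*, Cambridge University Press (2006), Ch. 7 §7.2.2 pp. 168–171.
-/

namespace Literature.Probability.Percolation.FivePoint.Boundary

open Finset Literature.Probability.Percolation Literature.Probability.LatticeModels Literature.Probability.Percolation.FivePoint
  TriMarkedDomain

variable (D : TriMarkedDomain 5)

/-! ## 0. Small facts on `Fin 3` / `Fin 5` -/

/-- Auxiliary. [folklore] -/
private theorem fin3_cases' (k j : Fin 3) : j = k ∨ j = k + 1 ∨ j = k + 2 := by
  revert k j; decide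

/-- Auxiliary. [folklore] -/
private theorem fin3_k (k : Fin 3) : k + 2 + 1 = k ∧ k + 2 + 2 = k + 1 ∧ k + 1 + 1 = k + 2 ∧ k + 1 + 2 = k := by
  revert k; decide

/-- Auxiliary. [folklore] -/
private theorem fin5_sub_one_ne (j : Fin 5) : j - 1 ≠ j := by
  revert j; decide

/-! ## 1. The exterior face `x`: hypotheses packaged -/

/-- `x` is an exterior boundary face seen from its `G`-vertex `k`: `faceVertex x k ∈ G`, the other two vertices outside `G`, and the two
boundary darts of `x` at that vertex lie on the same stretch. [cite: BollobasRiordan2006, Ch. 7 §7.2.2 pp. 168–171] -/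
structure IsExteriorFace (x : HexVertex) (k : Fin 3) : Prop where
  mem : faceVertex x k ∈ D.verts
  out₁ : faceVertex x (k + 1) ∉ D.verts
  out₂ : faceVertex x (k + 2) ∉ D.verts
  same_stretch : stretchIdx D (faceVertex x k, faceVertex x (k + 1)) = stretchIdx D (faceVertex x k, faceVertex x (k + 2))

variable {D}

/-- **geometric form of the hypothesis**: an exterior face (one vertex in `G`, two outside) that is NOT a corner face automatically has its
two boundary darts on the same stretch — consecutive boundary darts change stretch only at a marked dart, i.e. at a corner face. [cite: BollobasRiordan2006, Ch. 7 §7.2.2 pp. 168–171] -/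
theorem IsExteriorFace.of_not_corner {x : HexVertex} {k : Fin 3} (hk : faceVertex x k ∈ D.verts) (h1 : faceVertex x (k + 1) ∉ D.verts)
    (h2 : faceVertex x (k + 2) ∉ D.verts) (hnc : ∀ j : Fin 5, ¬ IsCornerFace D j x) : IsExteriorFace D x k := by
  refine ⟨hk, h1, h2, ?_⟩
  have hd : (faceVertex x k, faceVertex x (k + 1)) ∈ triBdryDarts D.verts := faceDart_mem₅ hk h1
  have hsucc : triBdrySucc D.verts (faceVertex x k, faceVertex x (k + 1)) = (faceVertex x k, faceVertex x (k + 2)) := by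
    rw [succ_faceDart₅, if_neg h2]
  have hd' : (faceVertex x k, faceVertex x (k + 2)) ∈ triBdryDarts D.verts := hsucc ▸ triBdrySucc_mem hd
  rw [stretchIdx_eq_posIdx D hd, stretchIdx_eq_posIdx D hd', ← hsucc, D.dpos_succ hd, posIdx_mod]
  refine (posIdx_succ_eq D fun i hi => ?_).symm
  have e1 := iter_eq_predDart D hi
  have e2 := iter_succ_eq_markDart D hi
  rw [D.iter_dpos hd] at e1
  rw [triBdryIter_succ, D.iter_dpos hd, hsucc] at e2
  apply hnc i
  unfold IsCornerFace
  rw [hexFaceVertices_eq_triple x k, TriMarkedDomain.markSite, ← e2, ← e1]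
  show ({faceVertex x k, faceVertex x (k + 1), faceVertex x (k + 2)} : Finset (Site 2)) =
    {faceVertex x k, faceVertex x (k + 2), faceVertex x (k + 1)}
  rw [Finset.pair_comm]

section exterior

variable {x : HexVertex} {k : Fin 3} (hx : IsExteriorFace D x k)
include hx

/-- the first boundary dart of `x` at `u`: `(u, v)`. [cite: BollobasRiordan2006, Ch. 7 §7.2.2 pp. 168–171] -/
theorem IsExteriorFace.dart_mem : (faceVertex x k, faceVertex x (k + 1)) ∈ triBdryDarts D.verts :=
  faceDart_mem₅ hx.mem hx.out₁

/-- … whose successor on the boundary cycle is the second one, `(u, v')` (the walk turns around the hexagon `u` through `x`). [cite: BollobasRiordan2006, Ch. 7 §7.2.2 pp. 168–171] -/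
theorem IsExteriorFace.succ_dart :
    triBdrySucc D.verts (faceVertex x k, faceVertex x (k + 1)) = (faceVertex x k, faceVertex x (k + 2)) := by
  rw [succ_faceDart₅, if_neg hx.out₂]

omit hx in
/-- the `H_G`-edge `{x₁, x}` is the dual of the dart `(u, v)` … [cite: BollobasRiordan2006, Ch. 7 §7.2.2 pp. 168–171] -/
theorem IsExteriorFace.faceEdge₁ : faceEdge (oppFace x (k + 2)) x = {faceVertex x k, faceVertex x (k + 1)} := by
  rw [faceEdge_comm, faceEdge_oppFace, (fin3_k k).1, (fin3_k k).2.1]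

omit hx in
/-- … and `{x, x₂}` is the dual of the dart `(u, v')`. [cite: BollobasRiordan2006, Ch. 7 §7.2.2 pp. 168–171] -/
theorem IsExteriorFace.faceEdge₂ : faceEdge x (oppFace x (k + 1)) = {faceVertex x (k + 2), faceVertex x k} := by
  rw [faceEdge_oppFace, (fin3_k k).2.2.1, (fin3_k k).2.2.2]

/-- `Bicol` across the outer side `{v, v'}` of `x` is impossible (no endpoint in `G`). [cite: KhristoforovSmirnov2021, §1.2 (loop configurations, pp. 3–4)] -/
theorem IsExteriorFace.not_bicol_outer (σ : SiteConfig (Site 2)) (r : Fin 5) (c : Bool) :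
    ¬ Bicol D σ r c (faceVertex x (k + 1)) (faceVertex x (k + 2)) := by
  rintro (⟨h1, -, -⟩ | ⟨h1, -, -⟩ | ⟨h1, -, -⟩)
  · exact hx.out₁ h1
  · exact hx.out₁ h1
  · exact hx.out₂ h1

/-- `Bicol` across the side `{u, v}`, unfolded: `u ∈ σ ↔` the exterior colour of the dart `(u, v)` is `false`. [cite: KhristoforovSmirnov2021, §1.2 (loop configurations, pp. 3–4)] -/
theorem IsExteriorFace.bicol_side₁_iff (σ : SiteConfig (Site 2)) (r : Fin 5) (c : Bool) :
    Bicol D σ r c (faceVertex x k) (faceVertex x (k + 1)) ↔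
      (faceVertex x k ∈ σ ↔ arcColour r c (stretchIdx D (faceVertex x k, faceVertex x (k + 1))) = false) := by
  unfold Bicol
  constructor
  · rintro (⟨-, h2, -⟩ | ⟨-, -, h⟩ | ⟨h1, -, -⟩)
    · exact absurd h2 hx.out₁
    · exact h
    · exact absurd h1 hx.out₁
  · intro h
    exact Or.inr (Or.inl ⟨hx.mem, hx.out₁, h⟩)

/-- `Bicol` across the side `{v', u}`, unfolded likewise. [cite: KhristoforovSmirnov2021, §1.2 (loop configurations, pp. 3–4)] -/
theorem IsExteriorFace.bicol_side₂_iff (σ : SiteConfig (Site 2)) (r : Fin 5) (c : Bool) :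
    Bicol D σ r c (faceVertex x (k + 2)) (faceVertex x k) ↔
      (faceVertex x k ∈ σ ↔ arcColour r c (stretchIdx D (faceVertex x k, faceVertex x (k + 2))) = false) := by
  unfold Bicol
  constructor
  · rintro (⟨h1, -, -⟩ | ⟨h1, -, -⟩ | ⟨-, -, h⟩)
    · exact absurd h1 hx.out₂
    · exact absurd h1 hx.out₂
    · exact h
  · intro h
    exact Or.inr (Or.inr ⟨hx.mem, hx.out₂, h⟩)

/-- **same exterior colour on both `H_G`-sides of `x`**: the side towards `x₁ = oppFace x (k+2)` is bicoloured iff the side towards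
`x₂ = oppFace x (k+1)` is. [cite: KhristoforovSmirnov2021, §1.2 (loop configurations, pp. 3–4)] -/
theorem IsExteriorFace.bicol_sides_iff (σ : SiteConfig (Site 2)) (r : Fin 5) (c : Bool) :
    Bicol D σ r c (faceVertex x (k + 2 + 1)) (faceVertex x (k + 2 + 2)) ↔
      Bicol D σ r c (faceVertex x (k + 1 + 1)) (faceVertex x (k + 1 + 2)) := by
  obtain ⟨e1, e2, e3, e4⟩ := fin3_k k
  rw [e1, e2, e3, e4, hx.bicol_side₁_iff, hx.bicol_side₂_iff, hx.same_stretch]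

/-- an `H_G`-step out of `x` goes to `x₁` or `x₂` (the outer side has no site of `G`). [cite: BollobasRiordan2006, Ch. 7 §7.2.2 pp. 168–171] -/
theorem IsExteriorFace.hStep_cases {z : HexVertex} (h : HStep D x z) : z = oppFace x (k + 2) ∨ z = oppFace x (k + 1) := by
  obtain ⟨hadj, w, hw, hwG⟩ := h
  obtain ⟨j, rfl⟩ := exists_oppFace_eq_of_hexGraph_adj hadj
  rw [faceEdge_oppFace, Finset.mem_insert, Finset.mem_singleton] at hw
  rcases fin3_cases' k j with rfl | rfl | rfl
  · rcases hw with rfl | rfl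
    · exact absurd hwG hx.out₁
    · exact absurd hwG hx.out₂
  · exact Or.inr rfl
  · exact Or.inl rfl

/-- an `IStep` out of `x` goes to `x₁` or `x₂`, and then BOTH sides of `x` towards `G` are bicoloured. [cite: KhristoforovSmirnov2021, §1.2 (loop configurations, pp. 3–4)] -/
theorem IsExteriorFace.iStep_cases {σ : SiteConfig (Site 2)} {r : Fin 5} {c : Bool} {z : HexVertex} (h : IStep D σ r c x z) :
    (z = oppFace x (k + 2) ∨ z = oppFace x (k + 1)) ∧
      IStep D σ r c x (oppFace x (k + 2)) ∧ IStep D σ r c x (oppFace x (k + 1)) := by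
  obtain ⟨j, rfl, hb⟩ := (iStep_iff D σ r c x z).1 h
  rcases fin3_cases' k j with rfl | rfl | rfl
  · exact absurd hb (hx.not_bicol_outer σ r c)
  · have hb' := (hx.bicol_sides_iff σ r c).2 hb
    exact ⟨Or.inr rfl, (iStep_iff D σ r c x _).2 ⟨k + 2, rfl, hb'⟩, (iStep_iff D σ r c x _).2 ⟨k + 1, rfl, hb⟩⟩
  · have hb' := (hx.bicol_sides_iff σ r c).1 hb
    exact ⟨Or.inl rfl, (iStep_iff D σ r c x _).2 ⟨k + 2, rfl, hb⟩, (iStep_iff D σ r c x _).2 ⟨k + 1, rfl, hb'⟩⟩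

/-- `x` is not a corner face: a corner face's two boundary darts are `predDart j` and `markDart j`, on DIFFERENT stretches. [cite: BollobasRiordan2006, Ch. 7 §7.2.2 pp. 168–171] -/
theorem IsExteriorFace.not_cornerFace (j : Fin 5) : ¬ IsCornerFace D j x := by
  intro hc
  obtain ⟨w, hw, hw1, hw2, hor⟩ := isCornerFace_typeII D hc
  -- the `G`-vertex of `x` is unique, so `w = k`
  have hwk : w = k := by
    rcases fin3_cases' k w with h | h | h
    · exact h
    · exact absurd (h ▸ hw ▸ markSite_mem D j : faceVertex x (k + 1) ∈ D.verts) hx.out₁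
    · exact absurd (h ▸ hw ▸ markSite_mem D j : faceVertex x (k + 2) ∈ D.verts) hx.out₂
  subst hwk
  have hs := hx.same_stretch
  have hp : predDart D j = (D.markSite j, (predDart D j).2) := Prod.ext (predDart_fst D j) rfl
  have hm : D.markDart j = (D.markSite j, (D.markDart j).2) := Prod.ext rfl rfl
  rcases hor with ⟨h1, h2⟩ | ⟨h1, h2⟩
  · rw [hw, h1, h2, ← hp, ← hm, stretchIdx_predDart, stretchIdx_markDart] at hs
    exact fin5_sub_one_ne j hs
  · rw [hw, h1, h2, ← hp, ← hm, stretchIdx_predDart, stretchIdx_markDart] at hs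
    exact fin5_sub_one_ne j hs.symm

/-- **interface propagation**: if `x` is on an interface then so are both `x₁` and `x₂`. [cite: KhristoforovSmirnov2021, §1.2 (loop configurations, pp. 3–4)] -/
theorem IsExteriorFace.inInterface_nbrs {σ : SiteConfig (Site 2)} {r : Fin 5} {c : Bool} (h : InInterface D σ r c x) :
    InInterface D σ r c (oppFace x (k + 2)) ∧ InInterface D σ r c (oppFace x (k + 1)) := by
  obtain ⟨j, hj, Y, hY, hchain⟩ := h
  -- the chain from the corner face `Y ≠ x` has a last step `z → x`
  rcases hchain.cases_tail with e | ⟨z, hYz, hzx⟩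
  · exact absurd (e ▸ hY) (hx.not_cornerFace j)
  · have hxz : IStep D σ r c x z := iStep_symm D hzx
    obtain ⟨hz, h1, h2⟩ := hx.iStep_cases hxz
    have hIx : Relation.ReflTransGen (IStep D σ r c) Y x := hYz.tail hzx
    exact ⟨⟨j, hj, Y, hY, hIx.tail h1⟩, ⟨j, hj, Y, hY, hIx.tail h2⟩⟩

/-- `H_G`-steps from `x₁` and `x₂` into `x` (the shared side contains the site `u ∈ G`). [cite: BollobasRiordan2006, Ch. 7 §7.2.2 pp. 168–171] -/
theorem IsExteriorFace.hStep_in₁ : HStep D (oppFace x (k + 2)) x := by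
  refine ⟨(hexGraph_adj_oppFace x (k + 2)).symm, faceVertex x k, ?_, hx.mem⟩
  rw [faceEdge_comm, faceEdge_oppFace, (fin3_k k).1]
  exact Finset.mem_insert_self _ _

/-- … and from `x₂`. [cite: BollobasRiordan2006, Ch. 7 §7.2.2 pp. 168–171] -/
theorem IsExteriorFace.hStep_in₂ : HStep D (oppFace x (k + 1)) x := by
  refine ⟨(hexGraph_adj_oppFace x (k + 1)).symm, faceVertex x k, ?_, hx.mem⟩
  rw [faceEdge_comm, faceEdge_oppFace, (fin3_k k).2.2.2]
  exact Finset.mem_insert_of_mem (Finset.mem_singleton_self _)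

/-- **transfer**: a joined `H_G`-neighbour of `x` makes `x` joined (the interface cannot pass through `x` without passing through the
neighbour). [cite: KhristoforovSmirnov2021, §1.2 (loop configurations, pp. 3–4)] -/
theorem IsExteriorFace.joined_of_joined_nbr {σ : SiteConfig (Site 2)} {r : Fin 5} {c : Bool} {z : HexVertex}
    (hz : z = oppFace x (k + 2) ∨ z = oppFace x (k + 1)) (hJ : Joined D σ r c z) : Joined D σ r c x := by
  obtain ⟨hzI, Y, hY, hYI, hchain⟩ := hJ
  have hxI : ¬ InInterface D σ r c x := by
    intro hI
    obtain ⟨h1, h2⟩ := hx.inInterface_nbrs hI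
    rcases hz with rfl | rfl
    · exact hzI h1
    · exact hzI h2
  have hstep : HStep D z x := by
    rcases hz with rfl | rfl
    · exact hx.hStep_in₁
    · exact hx.hStep_in₂
  exact ⟨hxI, Y, hY, hYI, hchain.tail ⟨hstep, hzI, hxI⟩⟩

/-- conversely a joining chain into `x` enters through `x₁` or `x₂`, which is then joined. [cite: KhristoforovSmirnov2021, §1.2 (loop configurations, pp. 3–4)] -/
theorem IsExteriorFace.joined_nbr_of_joined {σ : SiteConfig (Site 2)} {r : Fin 5} {c : Bool} (hJ : Joined D σ r c x) :
    Joined D σ r c (oppFace x (k + 2)) ∨ Joined D σ r c (oppFace x (k + 1)) := by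
  obtain ⟨hxI, Y, hY, hYI, hchain⟩ := hJ
  rcases hchain.cases_tail with e | ⟨z, hYz, hzx⟩
  · exact absurd (e ▸ hY) (hx.not_cornerFace r)
  · obtain ⟨hst, hzI, -⟩ := hzx
    have hJz : Joined D σ r c z := ⟨hzI, Y, hY, hYI, hYz⟩
    rcases hx.hStep_cases (show HStep D x z from ⟨hst.1.symm, by rw [faceEdge_comm]; exact hst.2⟩) with rfl | rfl
    · exact Or.inl hJz
    · exact Or.inr hJz

/-- **THE SITE LAW (event form)**: at the two consecutive boundary edges `{x₁, x}` and `{x, x₂}` of the hexagon `u`, the mid-edge event is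
the same event, namely `Joined x`. [cite: KhristoforovSmirnov2021, §1.2 (loop configurations, pp. 3–4)] -/
theorem IsExteriorFace.joined_or_iff₁ (σ : SiteConfig (Site 2)) (r : Fin 5) (c : Bool) :
    (Joined D σ r c (oppFace x (k + 2)) ∨ Joined D σ r c x) ↔ Joined D σ r c x :=
  ⟨fun h => h.elim (fun h1 => hx.joined_of_joined_nbr (Or.inl rfl) h1) id, Or.inr⟩

/-- the same at the second edge `{x, x₂}`. [cite: KhristoforovSmirnov2021, §1.2 (loop configurations, pp. 3–4)] -/
theorem IsExteriorFace.joined_or_iff₂ (σ : SiteConfig (Site 2)) (r : Fin 5) (c : Bool) :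
    (Joined D σ r c x ∨ Joined D σ r c (oppFace x (k + 1))) ↔ Joined D σ r c x :=
  ⟨fun h => h.elim id (fun h2 => hx.joined_of_joined_nbr (Or.inr rfl) h2), Or.inl⟩

/-- the mid-edge events at the two edges coincide. [cite: KhristoforovSmirnov2021, §1.2 (loop configurations, pp. 3–4)] -/
theorem IsExteriorFace.midEdgeEvent_eq (r : Fin 5) (c : Bool) :
    midEdgeEvent D r c (oppFace x (k + 2)) x = midEdgeEvent D r c x (oppFace x (k + 1)) := by
  ext σ
  show (Joined D σ r c (oppFace x (k + 2)) ∨ Joined D σ r c x) ↔ (Joined D σ r c x ∨ Joined D σ r c (oppFace x (k + 1)))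
  rw [hx.joined_or_iff₁, hx.joined_or_iff₂]

/-- **(T-SITE), probabilities**: `midEdgeProb` agrees at the two consecutive boundary edges of the hexagon `u`. [cite: KhristoforovSmirnov2021, §1.2 (loop configurations, pp. 3–4)] -/
theorem IsExteriorFace.midEdgeProb_eq (r : Fin 5) (c : Bool) :
    midEdgeProb D r c (oppFace x (k + 2)) x = midEdgeProb D r c x (oppFace x (k + 1)) := by
  unfold midEdgeProb
  rw [hx.midEdgeEvent_eq]

/-- **(T-SITE), pattern probabilities**: every `H_{r,M}` agrees at the two edges. [cite: KhristoforovSmirnov2021, §1.2 (loop configurations, pp. 3–4)] -/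
theorem IsExteriorFace.patternProb_eq (r : Fin 5) (c m : Bool) :
    patternProb D r c m (oppFace x (k + 2)) x = patternProb D r c m x (oppFace x (k + 1)) := by
  unfold patternProb
  congr 1
  ext σ
  show (if m then MatchB D σ r c else MatchA D σ r c) ∧ (Joined D σ r c (oppFace x (k + 2)) ∨ Joined D σ r c x) ↔
    (if m then MatchB D σ r c else MatchA D σ r c) ∧ (Joined D σ r c x ∨ Joined D σ r c (oppFace x (k + 1)))
  rw [hx.joined_or_iff₁, hx.joined_or_iff₂]

/-- **(T-SITE), observables**: every sparse observable `F_j` agrees at the two edges. [cite: KhristoforovSmirnov2021, §1.2 (loop configurations, pp. 3–4)] -/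
theorem IsExteriorFace.sparseObs_eq (j : Fin 5) (c : Bool) :
    sparseObs D j c (oppFace x (k + 2)) x = sparseObs D j c x (oppFace x (k + 1)) := by
  unfold sparseObs
  rw [hx.patternProb_eq, hx.patternProb_eq, hx.patternProb_eq]

end exterior

/-! ## 2. The corner face of the reference mark: same-reference half of (T-CORNER) -/

section corner

variable {Y : HexVertex} {r : Fin 5} (hY : IsCornerFace D r Y)
include hY

/-- anything joined to `y_r` shows `y_r` is off the interfaces, hence `y_r` is (trivially) joined to itself. [cite: KhristoforovSmirnov2021, §1.2 (loop configurations, pp. 3–4)] -/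
theorem joined_corner_of_joined {σ : SiteConfig (Site 2)} {c : Bool} {x : HexVertex} (hJ : Joined D σ r c x) : Joined D σ r c Y := by
  obtain ⟨-, Y', hY', hY'I, -⟩ := hJ
  have e : Y' = Y := cornerFace_unique D hY' hY
  subst e
  exact ⟨hY'I, Y', hY', hY'I, Relation.ReflTransGen.refl⟩

/-- **THE CORNER LAW (same reference, event form)**: at any edge containing the corner face `y_r`, the `r`-mid-edge event is `Joined y_r`. [cite: KhristoforovSmirnov2021, §1.2 (loop configurations, pp. 3–4)] -/
theorem joined_or_corner_iff (σ : SiteConfig (Site 2)) (c : Bool) (x : HexVertex) :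
    (Joined D σ r c x ∨ Joined D σ r c Y) ↔ Joined D σ r c Y :=
  ⟨fun h => h.elim (joined_corner_of_joined hY) id, Or.inr⟩

/-- the same with the corner face written first. [cite: KhristoforovSmirnov2021, §1.2 (loop configurations, pp. 3–4)] -/
theorem corner_or_joined_iff (σ : SiteConfig (Site 2)) (c : Bool) (x : HexVertex) :
    (Joined D σ r c Y ∨ Joined D σ r c x) ↔ Joined D σ r c Y :=
  ⟨fun h => h.elim id (joined_corner_of_joined hY), Or.inl⟩

/-- **(T-CORNER, same reference), probabilities**: for ANY two faces `x, x'` (in particular the outer faces across `predDart r` and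
`markDart r`), `H_{r,M}` at the edge `{x, y_r}` equals `H_{r,M}` at `{y_r, x'}`. [cite: KhristoforovSmirnov2021, §1.2 (loop configurations, pp. 3–4)] -/
theorem corner_patternProb_eq (c m : Bool) (x x' : HexVertex) :
    patternProb D r c m x Y = patternProb D r c m Y x' := by
  unfold patternProb
  congr 1
  ext σ
  show (if m then MatchB D σ r c else MatchA D σ r c) ∧ (Joined D σ r c x ∨ Joined D σ r c Y) ↔
    (if m then MatchB D σ r c else MatchA D σ r c) ∧ (Joined D σ r c Y ∨ Joined D σ r c x')
  rw [joined_or_corner_iff hY, corner_or_joined_iff hY]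

/-- **(T-CORNER, same reference), mid-edge probabilities**: `midEdgeProb D r c x y_r = midEdgeProb D r c y_r x'` for any `x, x'`. [cite: KhristoforovSmirnov2021, §1.2 (loop configurations, pp. 3–4)] -/
theorem corner_midEdgeProb_eq (c : Bool) (x x' : HexVertex) :
    midEdgeProb D r c x Y = midEdgeProb D r c Y x' := by
  unfold midEdgeProb
  congr 1
  ext σ
  show (Joined D σ r c x ∨ Joined D σ r c Y) ↔ (Joined D σ r c Y ∨ Joined D σ r c x')
  rw [joined_or_corner_iff hY, corner_or_joined_iff hY]

end corner

/-! ## 3. The site law in dart form: two consecutive boundary darts of one hexagon on one stretch -/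

section darts

/-- **(T-SITE) in dart form**: if the boundary dart `(u, v)` of the `i`-th stretch is followed on the boundary cycle by a dart `(u, w)`
of the SAME hexagon `u` and the same stretch, then the pattern probabilities at the two dual `H_G`-edges `{leftFace v u, leftFace u v}`
and `{leftFace u v, leftFace u w}` coincide (the exterior face between the two darts is `leftFace u v`, with apex `w`). [cite: BollobasRiordan2006, Ch. 7 §7.2.2 pp. 168–171] -/
theorem site_law_darts {i : Fin 5} {u v w : Site 2} (hd : (u, v) ∈ D.stretch i) (hd' : (u, w) ∈ D.stretch i)
    (hsucc : triBdrySucc D.verts (u, v) = (u, w)) (r : Fin 5) (c m : Bool) :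
    patternProb D r c m (leftFace v u) (leftFace u v) = patternProb D r c m (leftFace u v) (leftFace u w) := by
  obtain ⟨hdB, hpos⟩ := posIdx_dpos_of_mem_stretch D hd
  obtain ⟨hdB', hpos'⟩ := posIdx_dpos_of_mem_stretch D hd'
  obtain ⟨huG, hvG, hadj⟩ := mem_triBdryDarts.1 hdB
  obtain ⟨-, hwG, -⟩ := mem_triBdryDarts.1 hdB'
  obtain ⟨k, hu, hv⟩ := exists_eq_faceVertex_of_adj hadj
  obtain ⟨e1, e2, e3, e4⟩ := fin3_k k
  -- the apex: `w = faceVertex (leftFace u v) (k + 2)`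
  have hsucc' := succ_faceDart₅ D.verts (F := leftFace u v) (j := k)
  rw [← hu, ← hv, hsucc] at hsucc'
  have hw : w = faceVertex (leftFace u v) (k + 2) := by
    by_cases h : faceVertex (leftFace u v) (k + 2) ∈ D.verts
    · rw [if_pos h] at hsucc'
      have hu' : u = faceVertex (leftFace u v) (k + 2) := (Prod.ext_iff.1 hsucc').1
      exact absurd (hu'.symm.trans hu) (faceVertex_add_ne (leftFace u v) k (k := 2) (by decide))
    · rw [if_neg h] at hsucc'
      exact (Prod.ext_iff.1 hsucc').2
  have hx : IsExteriorFace D (leftFace u v) k := by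
    refine ⟨hu ▸ huG, hv ▸ hvG, hw ▸ hwG, ?_⟩
    rw [← hu, ← hv, ← hw, stretchIdx_eq_posIdx D hdB, stretchIdx_eq_posIdx D hdB', hpos, hpos']
  have f1 : oppFace (leftFace u v) (k + 2) = leftFace v u := by
    rw [← leftFace_faceVertex_rev (leftFace u v) (k + 2), e2, e1, ← hu, ← hv]
  have f2 : oppFace (leftFace u v) (k + 1) = leftFace u w := by
    rw [← leftFace_faceVertex_rev (leftFace u v) (k + 1), e4, e3, ← hu, ← hw]
  rw [← f1, ← f2]
  exact hx.patternProb_eq r c m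

/-- … and likewise for `midEdgeProb`. [cite: BollobasRiordan2006, Ch. 7 §7.2.2 pp. 168–171] -/
theorem site_law_darts_midEdgeProb {i : Fin 5} {u v w : Site 2} (hd : (u, v) ∈ D.stretch i) (hd' : (u, w) ∈ D.stretch i)
    (hsucc : triBdrySucc D.verts (u, v) = (u, w)) (r : Fin 5) (c : Bool) :
    midEdgeProb D r c (leftFace v u) (leftFace u v) = midEdgeProb D r c (leftFace u v) (leftFace u w) := by
  obtain ⟨hdB, hpos⟩ := posIdx_dpos_of_mem_stretch D hd
  obtain ⟨hdB', hpos'⟩ := posIdx_dpos_of_mem_stretch D hd'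
  obtain ⟨huG, hvG, hadj⟩ := mem_triBdryDarts.1 hdB
  obtain ⟨-, hwG, -⟩ := mem_triBdryDarts.1 hdB'
  obtain ⟨k, hu, hv⟩ := exists_eq_faceVertex_of_adj hadj
  obtain ⟨e1, e2, e3, e4⟩ := fin3_k k
  have hsucc' := succ_faceDart₅ D.verts (F := leftFace u v) (j := k)
  rw [← hu, ← hv, hsucc] at hsucc'
  have hw : w = faceVertex (leftFace u v) (k + 2) := by
    by_cases h : faceVertex (leftFace u v) (k + 2) ∈ D.verts
    · rw [if_pos h] at hsucc'
      have hu' : u = faceVertex (leftFace u v) (k + 2) := (Prod.ext_iff.1 hsucc').1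
      exact absurd (hu'.symm.trans hu) (faceVertex_add_ne (leftFace u v) k (k := 2) (by decide))
    · rw [if_neg h] at hsucc'
      exact (Prod.ext_iff.1 hsucc').2
  have hx : IsExteriorFace D (leftFace u v) k := by
    refine ⟨hu ▸ huG, hv ▸ hvG, hw ▸ hwG, ?_⟩
    rw [← hu, ← hv, ← hw, stretchIdx_eq_posIdx D hdB, stretchIdx_eq_posIdx D hdB', hpos, hpos']
  have f1 : oppFace (leftFace u v) (k + 2) = leftFace v u := by
    rw [← leftFace_faceVertex_rev (leftFace u v) (k + 2), e2, e1, ← hu, ← hv]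
  have f2 : oppFace (leftFace u v) (k + 1) = leftFace u w := by
    rw [← leftFace_faceVertex_rev (leftFace u v) (k + 1), e4, e3, ← hu, ← hw]
  rw [← f1, ← f2]
  exact hx.midEdgeProb_eq r c

end darts

end Literature.Probability.Percolation.FivePoint.Boundary
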